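import Summits.QuantumFields.BalabanUV.T4Continuum.Support.ShellMeasureScalingSU2
import Literature.Analysis.Convexity.PrekopaLeindler

/-!
# `T4Continuum.ShellMeasureLogConcave` — member (λ) of the NE7c shell-measure census: (M1) from LOG-CONCAVITY of the
# sectioned weight and CONVEXITY of the classifier, via Prékopa–Leindler and a three-chord inequality; dimension-free,
# ray-loss-free, tilt-free (companion `ShellMeasureLogConcaveSU2`: the realized `SU(2)` headline, the exact-convexity
# price as defect arithmetic, and a negative certificate)
# (cell `pub-balaban`, sub-cell `t4`, spine estimate NE7c (node U5b), lineage t4-ne7c-p1 = PROVER seat P1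
# «shell-measure route», generation 24; tree target `Summits/QuantumFields/BalabanUV/T4Continuum/Support/`;
# ADDITIVE — imports `ShellMeasureScalingSU2` and the tree's `Literature.Analysis.Convexity.PrekopaLeindler`, modifies
# nothing)

HONEST FRAMING.  Finite four-torus programme, rung (B)+1 only — NOT infinite volume, NOT a mass gap, NOT the Clay
problem, NOT summit progress; (B), `BetaPertHyp`, (B^μ) are not mentioned because nothing here consumes them.  The
cell wall of NE7c — (M1) `T4ShellMeasure.SlotAntiConcentration` FOR BAŁABAN'S INDUCTIVELY DEFINED EFFECTIVE MEASURES —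
is NOT PRINTED in [Balaban 1983–89] (GAPS G-ne7cp1-1), asserted by nobody, and NOT moved by this file.  What this file
adds is ONE MORE MEMBER of the repair census of the smooth route, with its inputs typed and its failure mode certified.
Every declaration is kernel mathematics, 0 sorry; the one cited theorem (Prékopa–Leindler, Brascamp–Lieb 1976 Thm 3.3)
is IMPORTED from the tree (`Literature.Analysis.Convexity.prekopaLeindler_pi`), not restated.

THE MEMBER (λ) «LOG-CONCAVITY».  The smooth members typed so far obtain the density bound behind (M1) from a
DEFORMATION of the chart (dilation (α)/(β)/(γ′), local core map (γ_loc), one-bond translate (τ)): they pay the chart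
DIMENSION `dim E` (Jacobian of the deformation) and a RAY-WEIGHT LOSS `B_f` (forward log-Lipschitz constant of the
sectioned weight along the deformation — for (γ_loc) including the frozen exterior's FIRST-ORDER response `ℓ_j`,
`ShellMeasureScalingLocal` §4, GAPS G-ne7cp1-21∕-22, located NOT PRINTED).  Member (λ) uses NO deformation:
* (§2) if the chart-side weight `w` is LOG-CONCAVE (`IsLogConcaveWeight w`: `w((1−s)x + sy) ≥ w(x)^{1−s}·w(y)^s`) and
  the classifier `u` is CONVEX on the support of `w`, then by Prékopa–Leindler the sublevel function
  `F(r) = (vol.withDensity w){u < r}` is log-concave in `r` (`logConcaveSublevelOn_of_logConcave`) — the sets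
  `{u < (1−s)a + sb} ⊇ (1−s){u < a} + s{u < b}` are Minkowski-interpolated;
* (§1) a log-concave sublevel function and ONE coarse mass ratio `F(r₀) ≥ e^{−P}·mass` (`r₀ < θ(1−ρ)`) give, by the
  three-chord inequality of concave functions, `F(θ) − F(θ(1−ρ)) ≤ (1 − e^{−λP})·F(θ) ≤ λP·F(θ)`, `λ = θρ/(θ − r₀)`,
  i.e. (M1) `SlotAntiConcentration ν u θ ρ D` with `D = P·θ/(θ − r₀)` (`slotAntiConcentration_of_logConcaveSublevel`);
  at `r₀ = θ/2`: `D = 2P`, and `D = 2 log 2` when the classifier sits below HALF its threshold with probability `≥ 1/2`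
  (`slotAntiConcentration_of_logConcave`).
CONSEQUENCES, all kernel facts of §3: `D` does not see `dim E`; an AFFINE TILT `e^{ℓ(x) + c}` of the weight — the
frozen exterior's first-order term — preserves log-concavity EXACTLY (`isLogConcaveWeight_mul_exp_affine`), so (λ)
has no `B_f`, no `ℓ_j`, no depth, no centre; a convex hard window and any product of log-concave factors (co-tested
CONVEX classifiers' indicators, a Gaussian, `e^{−Φ}` with `Φ` convex) keep it (`…_indicator`, `…_mul`, `…_exp_neg`);
the linearised classifier `x ↦ sup_p ‖L_p x‖` is convex (`convex_sup_norm_linear`).  The companion module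
`ShellMeasureLogConcaveSU2` carries (§1 there) the REALIZED headline for `G = SU(2)` in the frame of
`ShellMeasureScalingSU2.slotAntiConcentration_realized_su2_of_coreMap` with (S-i)/(S-ii) REPLACED by (C-i) convexity
of the sectioned classifier in the chart, (C-ii) log-concavity of the chart-side sectioned weight, (C-iii) the
half-threshold mass ratio per section (conclusion (M1) with `D = 2P` for the realized law), (§2 there) THE PRICE — a
classifier within `η` of a convex one inherits (M1) only with `ρ` replaced by `(θρ + 2η)/(θ + η)`: the convexity
defect enters ADDITIVELY, so for Bałaban's verbatim classifier (B14 (2.17): holonomy deviation of the NONLINEAR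
localized minimiser; second-order defect `η/θ ≍ C·R_j²ε_j`, K-uniform but `≫ ρ_j ≍ L^{−αj}`) member (λ) yields
NOTHING, exactly like the global dilations (D3 of the record), while it is instantiable for (a) the LINEARISED
(convexified) classifier — a design reading of the species of (L1) (B15 p. 181: regularity conditions may be changed
by a factor; the linearised condition is sandwiched between two printed ones at thresholds `θ(1 ∓ C·R_j²ε_j)`) — and
(b) the abelian model, where minimiser and classifier are linear; and (§3 there) the kernel NEGATIVE CERTIFICATE that
convexity cannot be weakened to smoothness (classifier `1 − x²` under the uniform law on `[−1,1]`: shell mass `2√ρ`).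

WHAT THIS DOES NOT DO.  No instance of (C-i)/(C-ii)/(C-iii) for Bałaban's sectioned block weights / classifiers is
constructed; the log-concavity of the SU(2) chart Jacobian `e^{−jac_e} = ∏_b (2π²)⁻¹sinc²|x_b|` (true on the cube
`3S² < π²`: `(−log sinc)″ = 1/sin²r − 1/r² > 0` on `(0,π)`, caveat (JAC) of `T4HaarSU2ExpChart`) is NOT proved here, so
(C-ii) is asked of the FULL chart-side weight `1_{[-S,S]ⁿ}·e^{−jac_e}·(R V ∘ κ)`; (Det), (FI-sat), (LR), (MR), (W1),
the (F∞)-rate keep their status; the design reading (λ-1) «convex classifiers» is located, not printed.  NE7c NOT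
proved.  Literature: Prékopa–Leindler / Borell (log-concave measures: C. Borell, *Convex measures on locally convex
spaces*, Ark. Mat. 12 (1974) 239–252; A. Prékopa, Acta Sci. Math. 34 (1973) 335–343) is the only external input and
enters through the tree theorem; the Gaussian sharpening (Ehrhard: `Φ⁻¹∘F` concave, giving `D ≍ P·e^{−P}`-type
constants at a tail threshold) is NOT used.
-/

namespace Summit.QuantumFields.BalabanUV.T4Continuum.ShellMeasureLogConcave

open MeasureTheory Set Function
open scoped ENNReal
open Literature.MathematicalPhysics.QuantumFieldTheory.Balaban1983to89
open T4ShellMeasure (SlotAntiConcentration)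

/-! ## §1 The three-chord engine: (M1) from a log-concave sublevel function and one coarse mass ratio -/

section Engine

variable {Ω : Type*} [MeasurableSpace Ω]

/-- NAMED HYPOTHESIS SHAPE (C-0): the sublevel function `r ↦ ν{u < r}` of the classifier `u` under `ν` is LOG-CONCAVE
on `[r₀, θ]`, in the multiplicative three-point (Prékopa–Leindler) form
`ν{u < a}^{1−s} · ν{u < b}^s ≤ ν{u < (1−s)a + sb}`.  Not asserted for any measure of Bałaban's. [folklore] -/
def LogConcaveSublevelOn (ν : Measure Ω) (u : Ω → ℝ) (r₀ θ : ℝ) : Prop :=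
  ∀ ⦃a b s : ℝ⦄, r₀ ≤ a → a ≤ θ → r₀ ≤ b → b ≤ θ → 0 < s → s < 1 →
    ν {x | u x < a} ^ (1 - s) * ν {x | u x < b} ^ s ≤ ν {x | u x < (1 - s) * a + s * b}

/-- real three-chord arithmetic: `0 ≤ A ≤ B ≤ M`, `C^λ·B^{1−λ} ≤ A`, `M ≤ e^P·C`, `λ ≥ 0`, `P ≥ 0` give
`B − A ≤ λ·P·M` (through `A ≥ e^{−λP}·B` and `1 − e^{−x} ≤ x`; `λ ≤ 1` is not needed). [folklore] -/
theorem threeChord_real {A B C M P lam : ℝ} (hA : 0 ≤ A) (hAB : A ≤ B) (hBM : B ≤ M) (hP : 0 ≤ P)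
    (hl0 : 0 ≤ lam) (hkey : C ^ lam * B ^ (1 - lam) ≤ A) (hmass : M ≤ Real.exp P * C) :
    B - A ≤ lam * P * M := by
  have hM : 0 ≤ M := hA.trans (hAB.trans hBM)
  rcases eq_or_lt_of_le (hA.trans hAB) with hB | hB
  · -- B = 0
    rw [← hB] at hAB ⊢
    have : 0 ≤ lam * P * M := by positivity
    linarith
  · -- B > 0: C ≥ e^{-P} B > 0
    have hC : Real.exp (-P) * B ≤ C := by
      have h1 : Real.exp (-P) * M ≤ C := by
        rw [Real.exp_neg]
        have hexp : 0 < Real.exp P := Real.exp_pos P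
        calc (Real.exp P)⁻¹ * M ≤ (Real.exp P)⁻¹ * (Real.exp P * C) :=
              mul_le_mul_of_nonneg_left hmass (inv_nonneg.2 hexp.le)
          _ = C := by field_simp
      exact (mul_le_mul_of_nonneg_left hBM (Real.exp_pos _).le).trans h1
    have hC0 : 0 ≤ Real.exp (-P) * B := by positivity
    -- e^{-lam P} B = (e^{-P} B)^lam * B^(1-lam) ≤ C^lam * B^(1-lam) ≤ A
    have hpow : (Real.exp (-P) * B) ^ lam * B ^ (1 - lam) ≤ C ^ lam * B ^ (1 - lam) :=
      mul_le_mul_of_nonneg_right (Real.rpow_le_rpow hC0 hC hl0) (Real.rpow_nonneg hB.le _)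
    have hid : (Real.exp (-P) * B) ^ lam * B ^ (1 - lam) = Real.exp (-(lam * P)) * B := by
      rw [Real.mul_rpow (Real.exp_pos _).le hB.le, ← Real.exp_mul, mul_assoc, ← Real.rpow_add hB,
        show -P * lam = -(lam * P) by ring, show lam + (1 - lam) = (1 : ℝ) by ring, Real.rpow_one]
    have hAge : Real.exp (-(lam * P)) * B ≤ A := by rw [← hid]; exact hpow.trans hkey
    have h1e : 1 - Real.exp (-(lam * P)) ≤ lam * P := by
      have := Real.add_one_le_exp (-(lam * P)); linarith
    calc B - A ≤ B - Real.exp (-(lam * P)) * B := by linarith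
      _ = (1 - Real.exp (-(lam * P))) * B := by ring
      _ ≤ (lam * P) * B := mul_le_mul_of_nonneg_right h1e hB.le
      _ ≤ (lam * P) * M := mul_le_mul_of_nonneg_left hBM (by positivity)
      _ = lam * P * M := by ring

/-- **(M1) FROM A LOG-CONCAVE SUBLEVEL FUNCTION — THE THREE-CHORD ENGINE.**  `ν` of finite mass, `u` measurable,
`0 ≤ θ`, `0 ≤ ρ`, a base level `r₀ < θ` with `r₀ ≤ θ(1−ρ)`; HYPOTHESES: (C-0) `LogConcaveSublevelOn ν u r₀ θ` and the
COARSE MASS RATIO `ν(univ) ≤ e^P · ν{u < r₀}` (`P ≥ 0`).  CONCLUSION: `SlotAntiConcentration ν u θ ρ (P·θ/(θ − r₀))`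
— no dimension, no deformation depth, no ray-weight loss. [folklore] -/
theorem slotAntiConcentration_of_logConcaveSublevel (ν : Measure Ω) (hfin : ν univ ≠ ∞) {u : Ω → ℝ}
    (hu : Measurable u) {r₀ θ ρ P : ℝ} (hθ : 0 ≤ θ) (hρ : 0 ≤ ρ) (hr₀ : r₀ < θ) (hr : r₀ ≤ θ * (1 - ρ))
    (hP : 0 ≤ P) (hF : LogConcaveSublevelOn ν u r₀ θ)
    (hmass : ν univ ≤ ENNReal.ofReal (Real.exp P) * ν {x | u x < r₀}) :
    SlotAntiConcentration ν u θ ρ (P * θ / (θ - r₀)) := by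
  unfold SlotAntiConcentration
  -- names and finiteness
  set Fa := ν {x | u x < θ * (1 - ρ)} with hFa_def
  set Fb := ν {x | u x < θ} with hFb_def
  set Fc := ν {x | u x < r₀} with hFc_def
  have hne : ∀ s : Set Ω, ν s ≠ ∞ := fun s => ne_top_of_le_ne_top hfin (measure_mono (subset_univ _))
  have hθρ : θ * (1 - ρ) ≤ θ := by nlinarith
  have hsub : {x | u x < θ * (1 - ρ)} ⊆ {x | u x < θ} := fun x (hx : u x < _) => lt_of_lt_of_le hx hθρ
  have hshell : {x | θ * (1 - ρ) ≤ u x ∧ u x < θ} = {x | u x < θ} \ {x | u x < θ * (1 - ρ)} := by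
    ext x
    constructor
    · rintro ⟨h1, h2⟩; exact ⟨h2, fun h3 : u x < θ * (1 - ρ) => absurd h1 (not_le.2 h3)⟩
    · rintro ⟨h1, h2⟩; exact ⟨not_lt.1 h2, h1⟩
  have hmeas : MeasurableSet {x | u x < θ * (1 - ρ)} := measurableSet_lt hu measurable_const
  rw [hshell, measure_sdiff hsub hmeas.nullMeasurableSet (hne _)]
  -- the weight λ = θρ/(θ - r₀) ∈ [0,1]
  have hθr : 0 < θ - r₀ := by linarith
  set lam := θ * ρ / (θ - r₀) with hlam_def
  have hl0 : 0 ≤ lam := div_nonneg (mul_nonneg hθ hρ) hθr.le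
  have hl1 : lam ≤ 1 := by rw [hlam_def, div_le_one hθr]; linarith
  have hlev : (1 - (1 - lam)) * r₀ + (1 - lam) * θ = θ * (1 - ρ) := by
    rw [hlam_def]; field_simp; ring
  -- KEY (in `ℝ≥0∞`): Fc^λ · Fb^{1-λ} ≤ Fa, by cases on λ ∈ {0}, {1}, (0,1)
  have hCa : Fc ≤ Fa := measure_mono fun x (hx : u x < r₀) => lt_of_lt_of_le hx hr
  have hkey : Fc ^ lam * Fb ^ (1 - lam) ≤ Fa := by
    rcases eq_or_lt_of_le hl0 with h0 | h0
    · -- λ = 0: θρ = 0, the levels θ(1-ρ) and θ coincide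
      have hρθ : θ * ρ = 0 := by
        rw [hlam_def] at h0
        rcases div_eq_zero_iff.1 h0.symm with h | h
        · exact h
        · exact absurd h hθr.ne'
      have hab : Fa = Fb := by
        rw [hFa_def, hFb_def, show θ * (1 - ρ) = θ by linarith]
      rw [← h0, sub_zero, ENNReal.rpow_zero, ENNReal.rpow_one, one_mul, hab]
    rcases eq_or_lt_of_le hl1 with h1 | h1
    · -- λ = 1: monotonicity only
      rw [h1, sub_self, ENNReal.rpow_zero, ENNReal.rpow_one, mul_one]; exact hCa
    · -- 0 < λ < 1: the hypothesis at (a, b, s) = (r₀, θ, 1 - λ)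
      have h := hF (a := r₀) (b := θ) (s := 1 - lam) le_rfl hr₀.le hr₀.le le_rfl (by linarith) (by linarith)
      rw [hlev, show 1 - (1 - lam) = lam by ring] at h
      exact h
  -- pass to real numbers
  have hA : 0 ≤ Fa.toReal := ENNReal.toReal_nonneg
  have hAB : Fa.toReal ≤ Fb.toReal := ENNReal.toReal_mono (hne _) (measure_mono hsub)
  have hBM : Fb.toReal ≤ (ν univ).toReal := ENNReal.toReal_mono hfin (measure_mono (subset_univ _))
  have hkey' : Fc.toReal ^ lam * Fb.toReal ^ (1 - lam) ≤ Fa.toReal := by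
    have := ENNReal.toReal_mono (hne _) hkey
    rwa [ENNReal.toReal_mul, ← ENNReal.toReal_rpow, ← ENNReal.toReal_rpow] at this
  have hmass' : (ν univ).toReal ≤ Real.exp P * Fc.toReal := by
    have := ENNReal.toReal_mono (ENNReal.mul_ne_top ENNReal.ofReal_ne_top (hne _)) hmass
    rwa [ENNReal.toReal_mul, ENNReal.toReal_ofReal (Real.exp_pos P).le] at this
  have hreal := threeChord_real hA hAB hBM hP hl0 hkey' hmass'
  -- back to `ℝ≥0∞`
  have hDρ : lam * P = P * θ / (θ - r₀) * ρ := by rw [hlam_def]; field_simp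
  rw [← ENNReal.ofReal_toReal (hne {x | u x < θ}), ← ENNReal.ofReal_toReal (hne {x | u x < θ * (1 - ρ)}),
    ← ENNReal.ofReal_sub _ hA, ← ENNReal.ofReal_toReal hfin, ← ENNReal.ofReal_mul (by rw [← hDρ]; positivity)]
  refine ENNReal.ofReal_le_ofReal ?_
  calc Fb.toReal - Fa.toReal ≤ lam * P * (ν univ).toReal := hreal
    _ = P * θ / (θ - r₀) * ρ * (ν univ).toReal := by rw [hDρ]

end Engine

/-! ## §2 The grounding: log-concave weight × convex classifier ⇒ log-concave sublevel function (Prékopa–Leindler) -/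

section Grounding

/-- NAMED HYPOTHESIS SHAPE (C-ii): an `ℝ≥0∞`-valued weight on a real vector space is LOG-CONCAVE, in the pointwise
multiplicative form consumed by Prékopa–Leindler: `w(x)^{1−s}·w(y)^s ≤ w((1−s)x + sy)` for `0 < s < 1`. [folklore] -/
def IsLogConcaveWeight {E : Type*} [AddCommGroup E] [Module ℝ E] (w : E → ℝ≥0∞) : Prop :=
  ∀ x y : E, ∀ ⦃s : ℝ⦄, 0 < s → s < 1 → w x ^ (1 - s) * w y ^ s ≤ w ((1 - s) • x + s • y)

/-- NAMED HYPOTHESIS SHAPE (C-i): the classifier is CONVEX ON THE SUPPORT of the weight (pointwise form; nothing is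
asked where the weight vanishes). [folklore] -/
def ConvexOnSupport {E : Type*} [AddCommGroup E] [Module ℝ E] (w : E → ℝ≥0∞) (u : E → ℝ) : Prop :=
  ∀ x y : E, w x ≠ 0 → w y ≠ 0 → ∀ ⦃s : ℝ⦄, 0 < s → s < 1 → u ((1 - s) • x + s • y) ≤ (1 - s) * u x + s * u y

variable {n : ℕ}

/-- **LOG-CONCAVE WEIGHT × CONVEX CLASSIFIER ⇒ LOG-CONCAVE SUBLEVEL FUNCTION** (on `ℝⁿ` with Lebesgue measure, every
pair of levels): Prékopa–Leindler (tree theorem `Literature.Analysis.Convexity.prekopaLeindler_pi`, Brascamp–Lieb 1976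
Thm 3.3) applied to `f = 1_{u<a}·w`, `g = 1_{u<b}·w`, `h = 1_{u<(1−s)a+sb}·w`: convexity of `u` on the support gives
`h((1−s)x + sy) ≥ f(x)^{1−s} g(y)^s`. [folklore] -/
theorem logConcaveSublevelOn_of_logConcave {w : (Fin n → ℝ) → ℝ≥0∞} (hw : Measurable w)
    (hlc : IsLogConcaveWeight w) {u : (Fin n → ℝ) → ℝ} (hu : Measurable u) (hconv : ConvexOnSupport w u)
    (r₀ θ : ℝ) : LogConcaveSublevelOn ((volume : Measure (Fin n → ℝ)).withDensity w) u r₀ θ := by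
  intro a b s _ _ _ _ hs0 hs1
  have hms : ∀ c : ℝ, MeasurableSet {x : Fin n → ℝ | u x < c} := fun c => measurableSet_lt hu measurable_const
  have happly : ∀ c : ℝ, ((volume : Measure (Fin n → ℝ)).withDensity w) {x | u x < c} =
      ∫⁻ x, {x | u x < c}.indicator w x := fun c => by
    rw [withDensity_apply _ (hms c), lintegral_indicator (hms c)]
  rw [happly, happly, happly]
  refine Literature.Analysis.Convexity.prekopaLeindler_pi hs0 hs1 n (hw.indicator (hms a)) (hw.indicator (hms b))
    (hw.indicator (hms _)) fun x y => ?_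
  have h1s : 0 < 1 - s := by linarith
  by_cases hx : u x < a
  · by_cases hy : u y < b
    · rw [indicator_of_mem (show x ∈ {x | u x < a} from hx), indicator_of_mem (show y ∈ {x | u x < b} from hy)]
      by_cases hwx : w x = 0
      · rw [hwx, ENNReal.zero_rpow_of_pos h1s, zero_mul]; exact bot_le
      by_cases hwy : w y = 0
      · rw [hwy, ENNReal.zero_rpow_of_pos hs0, mul_zero]; exact bot_le
      have hz : (1 - s) • x + s • y ∈ {x | u x < (1 - s) * a + s * b} := by
        show u ((1 - s) • x + s • y) < (1 - s) * a + s * b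
        calc u ((1 - s) • x + s • y) ≤ (1 - s) * u x + s * u y := hconv x y hwx hwy hs0 hs1
          _ < (1 - s) * a + s * b := by nlinarith [mul_lt_mul_of_pos_left hx h1s, mul_lt_mul_of_pos_left hy hs0]
      rw [indicator_of_mem hz]
      exact hlc x y hs0 hs1
    · rw [indicator_of_notMem (show y ∉ {x | u x < b} from hy), ENNReal.zero_rpow_of_pos hs0, mul_zero]
      exact bot_le
  · rw [indicator_of_notMem (show x ∉ {x | u x < a} from hx), ENNReal.zero_rpow_of_pos h1s, zero_mul]
    exact bot_le

/-- **MEMBER (λ) — THE CHART-SIDE HEADLINE.**  On `ℝⁿ` with Lebesgue measure: a measurable LOG-CONCAVE weight `w` of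
finite mass (C-ii), a measurable classifier `u` CONVEX ON THE SUPPORT (C-i), a threshold `θ > 0`, `0 ≤ ρ ≤ 1/2`, and
the HALF-THRESHOLD MASS RATIO (C-iii) `mass ≤ e^P · (vol.withDensity w){u < θ/2}`, `P ≥ 0`.  CONCLUSION: (M1)
`SlotAntiConcentration (vol.withDensity w) u θ ρ (2P)` — `D = 2P` sees neither `n` nor any ray-weight loss; with
`P = log 2` (classifier below half-threshold with probability `≥ 1/2`): `D = 2 log 2`. [folklore] -/
theorem slotAntiConcentration_of_logConcave {w : (Fin n → ℝ) → ℝ≥0∞} (hw : Measurable w)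
    (hlc : IsLogConcaveWeight w) (hfin : ((volume : Measure (Fin n → ℝ)).withDensity w) univ ≠ ∞)
    {u : (Fin n → ℝ) → ℝ} (hu : Measurable u) (hconv : ConvexOnSupport w u) {θ ρ P : ℝ} (hθ : 0 < θ)
    (hρ0 : 0 ≤ ρ) (hρ : ρ ≤ 1 / 2) (hP : 0 ≤ P)
    (hmass : ((volume : Measure (Fin n → ℝ)).withDensity w) univ ≤
      ENNReal.ofReal (Real.exp P) * ((volume : Measure (Fin n → ℝ)).withDensity w) {x | u x < θ / 2}) :
    SlotAntiConcentration ((volume : Measure (Fin n → ℝ)).withDensity w) u θ ρ (2 * P) := by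
  have h := slotAntiConcentration_of_logConcaveSublevel ((volume : Measure (Fin n → ℝ)).withDensity w) hfin hu
    (r₀ := θ / 2) hθ.le hρ0 (by linarith) (by nlinarith) hP
    (logConcaveSublevelOn_of_logConcave hw hlc hu hconv (θ / 2) θ) hmass
  have hD : P * θ / (θ - θ / 2) = 2 * P := by field_simp; ring
  rwa [hD] at h

end Grounding

/-! ## §3 Why (λ) is dimension-free, window-free and TILT-FREE: closure facts, and the linearised classifier -/

section Closure

variable {E : Type*} [AddCommGroup E] [Module ℝ E]

/-- a product of log-concave weights is log-concave (co-tested convex classifiers' indicators, Gaussian × perturbation,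
weight × Jacobian …). [folklore] -/
theorem isLogConcaveWeight_mul {w₁ w₂ : E → ℝ≥0∞} (h₁ : IsLogConcaveWeight w₁) (h₂ : IsLogConcaveWeight w₂) :
    IsLogConcaveWeight fun x => w₁ x * w₂ x := by
  intro x y s hs0 hs1
  have h1s : 0 ≤ 1 - s := by linarith
  calc (w₁ x * w₂ x) ^ (1 - s) * (w₁ y * w₂ y) ^ s
      = (w₁ x ^ (1 - s) * w₁ y ^ s) * (w₂ x ^ (1 - s) * w₂ y ^ s) := by
        rw [ENNReal.mul_rpow_of_nonneg _ _ h1s, ENNReal.mul_rpow_of_nonneg _ _ hs0.le]; ring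
    _ ≤ w₁ ((1 - s) • x + s • y) * w₂ ((1 - s) • x + s • y) := mul_le_mul' (h₁ x y hs0 hs1) (h₂ x y hs0 hs1)

/-- restriction to a CONVEX window keeps log-concavity (the hard small-field cut-off of a convex classifier, the cube
window of the chart). [folklore] -/
theorem isLogConcaveWeight_indicator {K : Set E} (hK : Convex ℝ K) {w : E → ℝ≥0∞} (hw : IsLogConcaveWeight w) :
    IsLogConcaveWeight (K.indicator w) := by
  intro x y s hs0 hs1
  have h1s : 0 < 1 - s := by linarith
  by_cases hx : x ∈ K
  · by_cases hy : y ∈ K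
    · rw [indicator_of_mem hx, indicator_of_mem hy,
        indicator_of_mem (hK hx hy h1s.le hs0.le (by ring))]
      exact hw x y hs0 hs1
    · rw [indicator_of_notMem hy, ENNReal.zero_rpow_of_pos hs0, mul_zero]; exact bot_le
  · rw [indicator_of_notMem hx, ENNReal.zero_rpow_of_pos h1s, zero_mul]; exact bot_le

/-- the indicator of a convex window is itself a log-concave weight. [folklore] -/
theorem isLogConcaveWeight_indicator_one {K : Set E} (hK : Convex ℝ K) :
    IsLogConcaveWeight (K.indicator fun _ => (1 : ℝ≥0∞)) :=
  isLogConcaveWeight_indicator hK fun x y s _ _ => by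
    rw [ENNReal.one_rpow, ENNReal.one_rpow, one_mul]

/-- `e^{−Φ}` with `Φ` CONVEX is a log-concave weight (a positive quadratic form: the Gaussian; the sectioned small-field
action when its Hessian is dominated by the quadratic form — second-order dominance, not used here). [folklore] -/
theorem isLogConcaveWeight_exp_neg {Φ : E → ℝ} (hΦ : ConvexOn ℝ univ Φ) :
    IsLogConcaveWeight fun x => ENNReal.ofReal (Real.exp (-Φ x)) := by
  intro x y s hs0 hs1
  have h1s : 0 ≤ 1 - s := by linarith
  have hc := hΦ.2 (mem_univ x) (mem_univ y) h1s hs0.le (by ring)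
  simp only [smul_eq_mul] at hc
  rw [ENNReal.ofReal_rpow_of_nonneg (Real.exp_pos _).le h1s, ENNReal.ofReal_rpow_of_nonneg (Real.exp_pos _).le hs0.le,
    ← ENNReal.ofReal_mul (Real.rpow_nonneg (Real.exp_pos _).le _), ← Real.exp_mul, ← Real.exp_mul, ← Real.exp_add]
  exact ENNReal.ofReal_le_ofReal (Real.exp_le_exp.2 (by nlinarith))

/-- **AN AFFINE TILT COSTS NOTHING.**  If `w` is log-concave then so is `w·e^{ℓ(x) + c}` for every LINEAR `ℓ` and
constant `c` — with EQUALITY in the tilt factor.  For member (λ) the frozen exterior's FIRST-ORDER term (the linear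
response `ℓ_j` of `ShellMeasureScalingLocal` §4, criterion (ii′), GAPS G-ne7cp1-21∕-22) is therefore invisible: no
`B_f`, no depth, no centre. [folklore] -/
theorem isLogConcaveWeight_mul_exp_affine {w : E → ℝ≥0∞} (hw : IsLogConcaveWeight w) (ℓ : E →ₗ[ℝ] ℝ) (c : ℝ) :
    IsLogConcaveWeight fun x => w x * ENNReal.ofReal (Real.exp (ℓ x + c)) := by
  refine isLogConcaveWeight_mul hw fun x y s hs0 hs1 => le_of_eq ?_
  have h1s : 0 ≤ 1 - s := by linarith
  rw [ENNReal.ofReal_rpow_of_nonneg (Real.exp_pos _).le h1s, ENNReal.ofReal_rpow_of_nonneg (Real.exp_pos _).le hs0.le,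
    ← ENNReal.ofReal_mul (Real.rpow_nonneg (Real.exp_pos _).le _), ← Real.exp_mul, ← Real.exp_mul, ← Real.exp_add,
    map_add, map_smul, map_smul, smul_eq_mul, smul_eq_mul]
  congr 2; ring

/-- **THE LINEARISED CLASSIFIER IS CONVEX.**  `x ↦ sup_{p ∈ pl} ‖L_p x‖` over a finite non-empty family of linear maps
into a normed space (the linearised plaquette curvatures of the block, read in any norm on `𝔤`) is convex in the
pointwise form (C-i) asks — on the whole chart, whatever the weight. [folklore] -/
theorem convex_sup_norm_linear {F : Type*} [NormedAddCommGroup F] [NormedSpace ℝ F] {ι : Type*} (pl : Finset ι)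
    (hpl : pl.Nonempty) (L : ι → E →ₗ[ℝ] F) (w : E → ℝ≥0∞) :
    ConvexOnSupport w fun x => pl.sup' hpl fun p => ‖L p x‖ := by
  intro x y _ _ s hs0 hs1
  have h1s : 0 ≤ 1 - s := by linarith
  refine Finset.sup'_le hpl _ fun p hp => ?_
  calc ‖L p ((1 - s) • x + s • y)‖ = ‖(1 - s) • L p x + s • L p y‖ := by rw [map_add, map_smul, map_smul]
    _ ≤ (1 - s) * ‖L p x‖ + s * ‖L p y‖ := by
        refine (norm_add_le _ _).trans ?_
        rw [norm_smul, norm_smul, Real.norm_of_nonneg h1s, Real.norm_of_nonneg hs0.le]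
    _ ≤ (1 - s) * (pl.sup' hpl fun p => ‖L p x‖) + s * (pl.sup' hpl fun p => ‖L p y‖) :=
        add_le_add (mul_le_mul_of_nonneg_left (Finset.le_sup' (fun p => ‖L p x‖) hp) h1s)
          (mul_le_mul_of_nonneg_left (Finset.le_sup' (fun p => ‖L p y‖) hp) hs0.le)

end Closure

end Summit.QuantumFields.BalabanUV.T4Continuum.ShellMeasureLogConcave
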